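import Summits.SmoothPoincare4.SmoothPoincare4.Theorems.EntropyRungNoncompactShrinkerGapHeatCutoffToolkit
import HarnessLib

/-!
# Energy uniqueness (`w(·, a) = 0`, `w ∈ L²` ⇒ `w = 0`) for `∂ₛw = Δw − Qw`, `Q ≥ 0`, on a complete
# manifold (crux `EntropyRung.NoncompactShrinkerGap`, stmt-SmoothPoincare4-10868, line
# `collapsed-ends-usc`, v13; registered helper `helper_energyVanishing`)

Setting: `(M, g)` Riemannian, modelled on `ℝⁿ` (Hausdorff, second countable, NOT compact),
unweighted measure `dV`; cut-offs `η_k ∈ C_c^∞`, `0 ≤ η_k ≤ 1`, `η_k ↑`, eventually `= 1` near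
every point, `|Δη_k| ≤ C`; `w` smooth on `M × O`, `O ⊇ [a, b]` open, `∂ₛw = Δw − Qw` on `[a, b]`
with `Q ≥ 0` there (no regularity of `Q` is needed), `w(·, a) = 0`, `∫∫_{M×(a,b)} w² < ∞`.
Then `w = 0` on `M × [a, b]`.

* `integral_sq_cutoff_le` — for ONE cut-off `η ≥ 0`: `∫ w(·,s)² η ≤ ∫∫_{M×(a,b)} w² |Δη|`
  (`E(s) = ∫ w(·,s)² η`, `E' = 2∫ w η ∂ₛw ≤ 2∫ w η Δw = −2∫ η|∇w|² + ∫ w² Δη ≤ ∫ w² |Δη|`, by the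
  energy identity with a cut-off of `CutoffToolkit` with `V = 0`; FTC and Fubini);
* `helper_energyVanishing` — `∫∫ w² |Δη_k| → 0` (dominated convergence, `|Δη_k| ≤ C`, `Δη_k → 0`
  pointwise), `E_k(s) ↑` in `k`, so `E_k(s) = 0`; the continuous nonnegative integrand vanishes
  identically (the Riemannian measure charges open sets), and `η_k(x) = 1` for large `k`.

Source: the standard energy method for uniqueness of the heat equation with cut-offs on complete
manifolds, A. Grigor'yan, *Heat kernel and analysis on manifolds* (2009), Ch. 8 and §11.2; the
cut-off bookkeeping of J. A. Carrillo, L. Ni, Comm. Anal. Geom. 17 (2009), §4 [CarrilloNi2009].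
-/

noncomputable section

set_option linter.dupNamespace false

open scoped Manifold ContDiff ENNReal NNReal Topology
open MeasureTheory Set Filter
open Literature.Geometry.Lorentzian Literature.Geometry.Riemannian

namespace Summit.SmoothPoincare4.SmoothPoincare4.Theorems.NoncompactShrinkerGapHeat

open CutoffToolkit

section Vanishing

variable {n : ℕ} {M : Type*} [TopologicalSpace M] [T2Space M] [SecondCountableTopology M]
  [ChartedSpace (EuclideanSpace ℝ (Fin n)) M] [IsManifold (𝓡 n) ∞ M] [T3Space M]
  [MeasurableSpace M] [BorelSpace M]
  {g : PseudoRiemannianMetric (𝓡 n) ∞ (EuclideanSpace ℝ (Fin n)) (TangentSpace (𝓡 n) : M → Type _)}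
  [g.HasLeviCivita]

/-- **`∫ u η Δu ≤ ½ ∫ u² |Δη|`** for `u` smooth and a smooth compactly supported `η ≥ 0`: the
energy identity with a cut-off (`V = 0`) reads `∫ u η Δu = −∫ η|∇u|² + ½ ∫ u² Δη`.
[cite: CarrilloNi2009, §4 (integration by parts on the complete soliton)] -/
theorem integral_mul_cutoff_mul_dalembertian_le (hg : g.IsRiemannian) {u η : M → ℝ}
    (hu : ContMDiff (𝓡 n) 𝓘(ℝ, ℝ) ∞ u) (hη : ContMDiff (𝓡 n) 𝓘(ℝ, ℝ) ∞ η)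
    (hηc : HasCompactSupport η) (hη0 : ∀ x, 0 ≤ η x) :
    ∫ x, u x * η x * g.dalembertian u x ∂g.riemVolume ≤
      1 / 2 * ∫ x, u x ^ 2 * |g.dalembertian η x| ∂g.riemVolume := by
  haveI := CarrilloNi2009_shrinkerLSI.isFiniteMeasureOnCompacts_riemVolume hg
  have h2 : (2 : ℕ∞ω) ≤ (∞ : ℕ∞ω) := WithTop.coe_le_coe.mpr le_top
  have hid := integral_sub_mul_cutoff_mul_weightedLaplacian hg hu hη hηc
    (contMDiff_const (c := (0 : ℝ))) 0
  simp only [sub_zero, mvfderiv_const, ContinuousLinearMap.toLinearMap_zero, neg_zero,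
    Real.exp_zero, mul_one] at hid
  have h0 : ∀ (x : M) (β : Module.Dual ℝ (TangentSpace (𝓡 n) x)), g.innerDual x 0 β = 0 :=
    fun x β ↦ by simp [PseudoRiemannianMetric.innerDual]
  simp only [h0, sub_zero] at hid
  rw [hid]
  have hG : 0 ≤ ∫ x, η x * g.gradSq u x ∂g.riemVolume :=
    integral_nonneg fun x ↦ mul_nonneg (hη0 x) (g.gradSq_nonneg hg _ _)
  have hΔc : HasCompactSupport (g.dalembertian η) :=
    HasCompactSupport.intro hηc fun x hx ↦ g.dalembertian_eq_zero_of_notMem_tsupport hx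
  have hR : ∫ x, u x ^ 2 * g.dalembertian η x ∂g.riemVolume ≤
      ∫ x, u x ^ 2 * |g.dalembertian η x| ∂g.riemVolume := by
    refine integral_mono ?_ ?_ fun x ↦ ?_
    · exact ((hu.continuous.pow 2).mul (continuous_dalembertian g (hη.of_le h2))).integrable_of_hasCompactSupport
        hΔc.mul_left
    · exact ((hu.continuous.pow 2).mul
        (continuous_abs.comp (continuous_dalembertian g (hη.of_le h2)))).integrable_of_hasCompactSupport
        hΔc.abs.mul_left
    · exact mul_le_mul_of_nonneg_left (le_abs_self _) (sq_nonneg _)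
  linarith

/-- **One cut-off: `∫ w(·, s)² η ≤ ∫∫_{M×(a,b)} w² |Δη|`.** For `w` smooth on `M × O`
(`O ⊇ [a, b]` open) with `∂ₛw = Δw − Qw` on `[a, b]`, `Q ≥ 0`, `w(·, a) = 0`, and a smooth
compactly supported `η ≥ 0`: `E(s) = ∫ w(·,s)² η` has `E(a) = 0` and
`E' = 2∫ w η ∂ₛw ≤ 2∫ w η Δw ≤ ∫ w² |Δη|` on `[a, b]` (Leibniz rule,
`integral_mul_cutoff_mul_dalembertian_le`), so `E(s) ≤ ∫ₐᵇ∫ w² |Δη|` (FTC, Fubini).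
[cite: CarrilloNi2009, §4 (integration by parts on the complete soliton)] -/
theorem integral_sq_cutoff_le (hg : g.IsRiemannian) {η : M → ℝ} (hη : ContMDiff (𝓡 n) 𝓘(ℝ, ℝ) ∞ η)
    (hηc : HasCompactSupport η) (hη0 : ∀ x, 0 ≤ η x) {Q : ℝ → M → ℝ} {a b : ℝ} {O : Set ℝ}
    {w : M × ℝ → ℝ} (hO : IsOpen O) (habO : Icc a b ⊆ O) (hQ : ∀ s ∈ Icc a b, ∀ x, 0 ≤ Q s x)
    (hw : ContMDiffOn ((𝓡 n).prod 𝓘(ℝ, ℝ)) 𝓘(ℝ, ℝ) ∞ w (univ ×ˢ O))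
    (heq : ∀ s ∈ Icc a b, ∀ x, deriv (fun r ↦ w (x, r)) s =
      g.dalembertian (fun y ↦ w (y, s)) x - Q s x * w (x, s))
    (hwa : ∀ x, w (x, a) = 0) {s : ℝ} (hs : s ∈ Icc a b) :
    ∫ x, w (x, s) ^ 2 * η x ∂g.riemVolume ≤
      ∫ p, w p ^ 2 * |g.dalembertian η p.1|
        ∂(g.riemVolume.prod (volume : Measure ℝ)).restrict (univ ×ˢ Ioo a b) := by
  haveI := CarrilloNi2009_shrinkerLSI.isFiniteMeasureOnCompacts_riemVolume hg
  haveI := sigmaFinite_riemVolume hg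
  have h2 : (2 : ℕ∞ω) ≤ (∞ : ℕ∞ω) := WithTop.coe_le_coe.mpr le_top
  have hab : a ≤ b := le_trans hs.1 hs.2
  set μ : Measure M := g.riemVolume with hμ
  -- `w` as a family `ρ r x = w (x, r)`
  set ρ : ℝ → M → ℝ := fun r x ↦ w (x, r) with hρdef
  have hρ : ContMDiffOn ((𝓡 n).prod 𝓘(ℝ, ℝ)) 𝓘(ℝ, ℝ) ∞ (fun p : M × ℝ ↦ ρ p.2 p.1) (univ ×ˢ O) :=
    hw
  have hslice : ∀ r ∈ O, ContMDiff (𝓡 n) 𝓘(ℝ, ℝ) ∞ (ρ r) := fun r hr ↦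
    contMDiff_slice_of_contMDiffOn hρ hr
  have hρc : ContinuousOn (fun p : M × ℝ ↦ ρ p.2 p.1) (univ ×ˢ O) := hρ.continuousOn
  have hρ'c : ContinuousOn (fun p : M × ℝ ↦ deriv (fun r ↦ ρ r p.1) p.2) (univ ×ˢ O) :=
    continuousOn_deriv_time hO hρ
  have hF : ContinuousOn (fun p : M × ℝ ↦ ρ p.2 p.1 ^ 2) (univ ×ˢ O) := hρc.pow 2
  have hF' : ContinuousOn (fun p : M × ℝ ↦ 2 * ρ p.2 p.1 * deriv (fun r ↦ ρ r p.1) p.2)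
      (univ ×ˢ O) := (continuousOn_const.mul hρc).mul hρ'c
  have hd : ∀ r ∈ O, ∀ x, HasDerivAt (fun r' ↦ ρ r' x ^ 2)
      (2 * ρ r x * deriv (fun r' ↦ ρ r' x) r) r := by
    intro r hr x
    have h := (hasDerivAt_time hO hρ x hr).pow 2
    refine h.congr_deriv ?_
    norm_num
  -- the weights `η` and `|Δη|`
  have hΔc : Continuous (g.dalembertian η) := continuous_dalembertian g (hη.of_le h2)
  have hΔs : HasCompactSupport (g.dalembertian η) :=
    HasCompactSupport.intro hηc fun x hx ↦ g.dalembertian_eq_zero_of_notMem_tsupport hx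
  have hAc : Continuous fun x ↦ |g.dalembertian η x| := continuous_abs.comp hΔc
  have hAs : HasCompactSupport fun x ↦ |g.dalembertian η x| := hΔs.abs
  -- `E`, `E'`, `R⁺`
  set E : ℝ → ℝ := fun r ↦ ∫ x, ρ r x ^ 2 * η x ∂μ with hE
  set E' : ℝ → ℝ := fun r ↦ ∫ x, (2 * ρ r x * deriv (fun r' ↦ ρ r' x) r) * η x ∂μ with hE'
  set R : ℝ → ℝ := fun r ↦ ∫ x, ρ r x ^ 2 * |g.dalembertian η x| ∂μ with hR
  have hEd : ∀ r ∈ O, HasDerivAt E (E' r) r := fun r hr ↦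
    hasDerivAt_integral_mul_of_hasCompactSupport μ hη.continuous hηc hO hF hF' hd hr
  have hE'c : ContinuousOn E' O :=
    continuousOn_integral_mul_of_hasCompactSupport μ hη.continuous hηc hF'
  have hRc : ContinuousOn R O := continuousOn_integral_mul_of_hasCompactSupport μ hAc hAs hF
  -- `E' ≤ R` on `[a, b]`
  have hE'le : ∀ r ∈ Icc a b, E' r ≤ R r := by
    intro r hr
    have hrO := habO hr
    have hu := hslice r hrO
    -- pointwise `2 w ∂ₛw η ≤ 2 w η Δw` (the equation and `Q ≥ 0`, `η ≥ 0`)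
    have hpt : ∀ x, (2 * ρ r x * deriv (fun r' ↦ ρ r' x) r) * η x ≤
        2 * (ρ r x * η x * g.dalembertian (ρ r) x) := by
      intro x
      have he : deriv (fun r' ↦ ρ r' x) r = g.dalembertian (ρ r) x - Q r x * ρ r x := heq r hr x
      rw [he]
      nlinarith [hQ r hr x, hη0 x, sq_nonneg (ρ r x), mul_nonneg (mul_nonneg (hQ r hr x) (sq_nonneg (ρ r x))) (hη0 x)]
    have hi1 : Integrable (fun x ↦ (2 * ρ r x * deriv (fun r' ↦ ρ r' x) r) * η x) μ := by
      have hc : Continuous fun x ↦ deriv (fun r' ↦ ρ r' x) r :=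
        hρ'c.comp_continuous (f := fun x : M ↦ ((x, r) : M × ℝ)) (by fun_prop)
          fun x ↦ ⟨mem_univ _, hrO⟩
      exact (((continuous_const.mul hu.continuous).mul hc).mul hη.continuous).integrable_of_hasCompactSupport
        hηc.mul_left
    have hi2 : Integrable (fun x ↦ 2 * (ρ r x * η x * g.dalembertian (ρ r) x)) μ := by
      refine (continuous_const.mul ((hu.continuous.mul hη.continuous).mul
        (continuous_dalembertian g (hu.of_le h2)))).integrable_of_hasCompactSupport ?_
      exact (hηc.mul_left.mul_right).mul_left
    calc E' r ≤ ∫ x, 2 * (ρ r x * η x * g.dalembertian (ρ r) x) ∂μ := integral_mono hi1 hi2 hpt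
      _ = 2 * ∫ x, ρ r x * η x * g.dalembertian (ρ r) x ∂μ := integral_const_mul _ _
      _ ≤ 2 * (1 / 2 * ∫ x, ρ r x ^ 2 * |g.dalembertian η x| ∂μ) :=
          mul_le_mul_of_nonneg_left (integral_mul_cutoff_mul_dalembertian_le hg hu hη hηc hη0)
            (by norm_num)
      _ = R r := by ring
  -- FTC on `[a, s]`, monotonicity, and Fubini
  have hsO : Icc a s ⊆ O := (Icc_subset_Icc_right hs.2).trans habO
  have huIcc : uIcc a s = Icc a s := uIcc_of_le hs.1
  have hFTC : ∫ r in a..s, E' r = E s - E a :=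
    intervalIntegral.integral_eq_sub_of_hasDerivAt (fun r hr ↦ hEd r (hsO (huIcc ▸ hr)))
      ((hE'c.mono hsO).intervalIntegrable_of_Icc hs.1)
  have hEa : E a = 0 := by
    simp only [hE, hρdef, hwa]
    simp
  have hRi : IntervalIntegrable R volume a b := (hRc.mono habO).intervalIntegrable_of_Icc hab
  have hmono1 : ∫ r in a..s, E' r ≤ ∫ r in a..s, R r :=
    intervalIntegral.integral_mono_on hs.1 ((hE'c.mono hsO).intervalIntegrable_of_Icc hs.1)
      ((hRc.mono hsO).intervalIntegrable_of_Icc hs.1)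
      fun r hr ↦ hE'le r ⟨hr.1, hr.2.trans hs.2⟩
  have hR0 : ∀ r, 0 ≤ R r := fun r ↦
    integral_nonneg fun x ↦ mul_nonneg (sq_nonneg _) (abs_nonneg _)
  have hmono2 : ∫ r in a..s, R r ≤ ∫ r in a..b, R r :=
    intervalIntegral.integral_mono_interval le_rfl hs.1 hs.2
      (Eventually.of_forall fun r ↦ hR0 r) hRi
  have hFub : ∫ p, w p ^ 2 * |g.dalembertian η p.1|
      ∂(μ.prod (volume : Measure ℝ)).restrict (univ ×ˢ Ioo a b) = ∫ r in a..b, R r :=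
    integral_strip_eq_intervalIntegral μ hab
      (integrable_strip_mul_of_hasCompactSupport μ (F := fun p : M × ℝ ↦ w p ^ 2)
        (hF.mono (prod_mono le_rfl habO)) hAc hAs)
  have hEs : E s = ∫ x, w (x, s) ^ 2 * η x ∂μ := rfl
  rw [hFub, ← hEs]
  linarith

/-- **Energy uniqueness for `∂ₛw = Δw − Qw`, `Q ≥ 0`, on a complete manifold** (registered helper
`helper_energyVanishing` of the crux `EntropyRung.NoncompactShrinkerGap`): with cut-offs
`η_k ∈ C_c^∞`, `0 ≤ η_k ≤ 1`, `η_k ↑`, eventually `1` near every point, `|Δη_k| ≤ C`, a smooth `w`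
on `M × O` (`O ⊇ [a, b]` open) with `∂ₛw = Δw − Qw` on `[a, b]`, `w(·, a) = 0` and
`∫∫_{M×(a,b)} w² < ∞` vanishes on `M × [a, b]`: `∫ w(·,s)² η_k ≤ ∫∫ w² |Δη_k| → 0`
(`integral_sq_cutoff_le`, dominated convergence), the left side is non-decreasing in `k`, hence
`0`, and a continuous nonnegative function with zero integral against a measure charging open
sets vanishes. [cite: CarrilloNi2009, §4 (integration by parts on the complete soliton)] -/
theorem helper_energyVanishing : ∀ (n : ℕ) (M : Type*) [TopologicalSpace M] [T2Space M] [SecondCountableTopology M] [ChartedSpace (EuclideanSpace ℝ (Fin n)) M] [IsManifold (𝓡 n) ∞ M] [T3Space M] [MeasurableSpace M] [BorelSpace M] (g : PseudoRiemannianMetric (𝓡 n) ∞ (EuclideanSpace ℝ (Fin n)) (TangentSpace (𝓡 n) : M → Type _)) [g.HasLeviCivita], g.IsRiemannian → ∀ (η : ℕ → M → ℝ) (C : ℝ), (∀ k, ContMDiff (𝓡 n) 𝓘(ℝ, ℝ) ∞ (η k)) → (∀ k, HasCompactSupport (η k)) → (∀ k x, 0 ≤ η k x ∧ η k x ≤ 1)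 → (∀ k x, η k x ≤ η (k + 1) x) → (∀ x, ∀ᶠ k in atTop, ∀ᶠ y in 𝓝 x, η k y = 1) → (∀ k x, |g.dalembertian (η k) x| ≤ C) → ∀ (Q : ℝ → M → ℝ) (a b : ℝ) (O : Set ℝ) (w : M × ℝ → ℝ), a < b → IsOpen O → Icc a b ⊆ O → (∀ s ∈ Icc a b, ∀ x, 0 ≤ Q s x) → ContMDiffOn ((𝓡 n).prod 𝓘(ℝ, ℝ)) 𝓘(ℝ, ℝ) ∞ w (univ ×ˢ O) → (∀ s ∈ Icc a b, ∀ x, deriv (fun r ↦ w (x, r)) s = g.dalembertian (fun y ↦ w (y, s)) x - Q s x * w (x, s)) → (∀ x, w (x, a) = 0) → Integrable (fun p : M × ℝ ↦ w p ^ 2) ((g.riemVolume.prod (volume : Measure ℝ)).restrict (univ ×ˢ Ioo a b)) → ∀ s ∈ Icc a b, ∀ x, w (x, s) = 0 := by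
  intro n M _ _ _ _ _ _ _ _ g _ hg η C hηs hηc hη01 hmono hη1 hΔη Q a b O w hab hO habO hQ hw heq hwa
    hInt s hs x₀
  haveI := CarrilloNi2009_shrinkerLSI.isFiniteMeasureOnCompacts_riemVolume hg
  haveI := sigmaFinite_riemVolume hg
  haveI := isOpenPosMeasure_riemVolume hg
  have h2 : (2 : ℕ∞ω) ≤ (∞ : ℕ∞ω) := WithTop.coe_le_coe.mpr le_top
  set μ : Measure M := g.riemVolume with hμ
  set ν : Measure (M × ℝ) := (μ.prod (volume : Measure ℝ)).restrict (univ ×ˢ Ioo a b) with hν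
  -- the slice `u = w(·, s)` is smooth
  have hu : ContMDiff (𝓡 n) 𝓘(ℝ, ℝ) ∞ fun y ↦ w (y, s) :=
    contMDiff_slice_of_contMDiffOn (u := fun r y ↦ w (y, r)) hw (habO hs)
  -- Step 1: `E_k(s) ≤ r_k = ∫∫ w² |Δη_k|`
  have hstep : ∀ k, ∫ x, w (x, s) ^ 2 * η k x ∂μ ≤ ∫ p, w p ^ 2 * |g.dalembertian (η k) p.1| ∂ν :=
    fun k ↦ integral_sq_cutoff_le hg (hηs k) (hηc k) (fun x ↦ (hη01 k x).1) hO habO hQ hw heq hwa hs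
  -- Step 2: `r_k → 0`
  have hwc : ContinuousOn (fun p : M × ℝ ↦ w p ^ 2) (univ ×ˢ Ioo a b) :=
    (hw.continuousOn.mono (prod_mono le_rfl (Ioo_subset_Icc_self.trans habO))).pow 2
  have hr_meas : ∀ k, AEStronglyMeasurable (fun p : M × ℝ ↦ w p ^ 2 * |g.dalembertian (η k) p.1|) ν :=
    fun k ↦ aestronglyMeasurable_strip μ (hwc.mul ((continuous_abs.comp
      (continuous_dalembertian g ((hηs k).of_le h2))).comp continuous_fst).continuousOn)
  have hr_bd : ∀ k (p : M × ℝ), ‖w p ^ 2 * |g.dalembertian (η k) p.1|‖ ≤ C * w p ^ 2 := fun k p ↦ by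
    rw [Real.norm_eq_abs, abs_mul, abs_abs, abs_of_nonneg (sq_nonneg _), mul_comm]
    exact mul_le_mul_of_nonneg_right (hΔη k p.1) (sq_nonneg _)
  have hr_t : Tendsto (fun k ↦ ∫ p, w p ^ 2 * |g.dalembertian (η k) p.1| ∂ν) atTop (𝓝 0) := by
    have hlim : ∀ p : M × ℝ, Tendsto (fun k ↦ w p ^ 2 * |g.dalembertian (η k) p.1|) atTop (𝓝 0) :=
      fun p ↦ by
      refine tendsto_const_nhds.congr' ?_
      filter_upwards [dalembertian_cutoff_eventually_eq_zero (g := g) hη1 p.1] with k hk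
      rw [hk, abs_zero, mul_zero]
    have h := tendsto_integral_of_dominated_convergence (fun p : M × ℝ ↦ C * w p ^ 2) hr_meas
      (hInt.const_mul C) (fun k ↦ Eventually.of_forall (hr_bd k)) (Eventually.of_forall hlim)
    simpa using h
  -- Step 3: `E_k(s)` is non-decreasing in `k`, hence `E_k(s) ≤ 0`, hence `= 0`
  have hηmono : ∀ x, Monotone fun k ↦ η k x := fun x ↦ monotone_nat_of_le_succ fun k ↦ hmono k x
  have hEi : ∀ k, Integrable (fun x ↦ w (x, s) ^ 2 * η k x) μ := fun k ↦
    ((hu.continuous.pow 2).mul (hηs k).continuous).integrable_of_hasCompactSupport (hηc k).mul_left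
  have hEmono : ∀ k k', k ≤ k' → ∫ x, w (x, s) ^ 2 * η k x ∂μ ≤ ∫ x, w (x, s) ^ 2 * η k' x ∂μ :=
    fun k k' hkk' ↦ integral_mono (hEi k) (hEi k') fun x ↦
      mul_le_mul_of_nonneg_left (hηmono x hkk') (sq_nonneg _)
  have hE0 : ∀ k, ∫ x, w (x, s) ^ 2 * η k x ∂μ = 0 := by
    intro k
    refine le_antisymm ?_ (integral_nonneg fun x ↦ mul_nonneg (sq_nonneg _) (hη01 k x).1)
    refine ge_of_tendsto hr_t ?_
    filter_upwards [eventually_ge_atTop k] with k' hk'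
    exact (hEmono k k' hk').trans (hstep k')
  -- Step 4: the continuous nonnegative integrand vanishes identically; `η_k(x₀) = 1` for large `k`
  obtain ⟨k, hk⟩ := (hη1 x₀).exists
  have hk1 : η k x₀ = 1 := hk.self_of_nhds
  have hae : (fun x ↦ w (x, s) ^ 2 * η k x) =ᵐ[μ] 0 :=
    (integral_eq_zero_iff_of_nonneg (fun x ↦ mul_nonneg (sq_nonneg _) (hη01 k x).1) (hEi k)).1 (hE0 k)
  have hzero : (fun x ↦ w (x, s) ^ 2 * η k x) = 0 :=
    (Continuous.ae_eq_iff_eq μ ((hu.continuous.pow 2).mul (hηs k).continuous) continuous_const).1 hae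
  have hx := congrFun hzero x₀
  simp only [hk1, mul_one, Pi.zero_apply] at hx
  exact pow_eq_zero_iff (two_ne_zero) |>.1 hx

end Vanishing

end Summit.SmoothPoincare4.SmoothPoincare4.Theorems.NoncompactShrinkerGapHeat

end
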